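import Mathlib
import HarnessLib
import Summits.PneNP.PneNP.Theses.WitnessForging
import Summits.PneNP.PneNP.Theorems.WitnessForgingLocalSamplersMissShatteredSetsHelpers

/-!
# Route WitnessForging — support item `LocalSamplersMissShatteredSets` (stmt-PneNP-2435)

`Summit.PneNP.PneNP.Theses.WitnessForging.LocalSamplersMissShatteredSets`: for every locality `ℓ`
and `δ, ε > 0` there is `n₀` such that for `n ≥ n₀`, every nonempty `S ⊆ {0,1}^n` covered by
pairwise `δn`-separated clusters each meeting `S` in `≤ e^{-εn}|S|` points, and every `ℓ`-local map
`F : {0,1}^m → {0,1}^n`, some event `E` has `|Pr_r[F r ∈ E] − |S ∩ E|/|S|| > 1/3`.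

Proof (the class-free NC⁰ rung; discrete twin of the stability argument of
El Alaoui–Montanari–Sellke 2022). Suppose every event is `1/3`-close. Then `Pr[F r ∈ S] ≥ 2/3`.
Output bit `i` reads a set `T i` of `≤ ℓ` coins, so the fan-outs `c j = #{i : j ∈ T i}` sum to
`≤ ℓ n` and at most `D = ⌈ℓ/γ⌉` coins are heavy (`c j ≥ γ n`, `γ = δ²/(16(ℓ+1))`). Fix the heavy
coins to a pattern `κ` (a branch). For a bipartition `J ⊔ Jᶜ` of the clusters, the statistic
`g = dist(out, ⋃_J C) − dist(out, ⋃_{Jᶜ} C)` moves by `≤ 2 c j < 2γn` when a light coin is flipped,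
so the Poincaré (Efron–Stein) inequality on the cube — the tree theorem
`BiasedCube.var_le_sum_Ep_D_sq` at `p = 1/2` — gives `Σ (g − ḡ)² ≤ 2^m γ ℓ n² ≤ 2^m δ² n²/16`,
while `g ≤ −δn` on `⋃_J C` and `g ≥ δn` on `⋃_{Jᶜ} C`; by Chebyshev on the side opposite to the
mean, one side has mass `≤ 2^m/16`. A minimal-cut argument then yields ONE cluster carrying all
but `2^m/8` of the branch's `S`-mass. The union `E` of these `≤ 2^D` clusters has
`Pr[F r ∈ E] ≥ 2/3 − 1/8` (averaging over branches) but `μ_S(E) ≤ 2^D e^{−εn} < 1/5` for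
`n ≥ n₀ = ⌈5·2^D/ε⌉ + 1`, and `2/3 − 1/8 − 1/5 = 41/120 > 1/3`: contradiction.

References: D. El Alaoui, A. Montanari, M. Sellke, *Sampling from the SK Gibbs measure via
algorithmic stochastic localization*, FOCS 2022, §5 (stability obstruction from shattering);
E. Viola, *The complexity of distributions*, SIAM J. Comput. 41 (2012) (local samplers);
B. Efron, C. Stein, Ann. Statist. 9 (1981) (the variance inequality; tree file
`Literature/Probability/Moments/BiasedCubeSharpThreshold.lean`).
-/

namespace Summit.PneNP.PneNP.Theorems

open Finset

open Summit.PneNP.PneNP.Theses.WitnessForging in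
/-- **The NC⁰ rung, class-free form** (item stmt-PneNP-2435 of route PneNP/WitnessForging):
`ℓ`-local maps cannot `1/3`-forge the uniform measure on any `δn`-separated clustering whose
clusters have relative mass `≤ e^{−εn}`, for `n ≥ n₀(ℓ, δ, ε)`. Proof: see the module docstring
(fan-out counting, conditioning on the `≤ ℓ/γ` heavy coins, Poincaré/Efron–Stein + Chebyshev per
branch via `exists_cluster_ge`, union over the `2^{|H|}` branches). [folklore; discrete twin of
El Alaoui–Montanari–Sellke 2022 §5; Viola 2012] -/
theorem localSamplersMissShatteredSets_proof : LocalSamplersMissShatteredSets := by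
  intro ℓ δ ε hδ hε
  -- constants
  obtain ⟨γ, hγdef⟩ : ∃ γ : ℝ, γ = δ ^ 2 / (16 * ((ℓ : ℝ) + 1)) := ⟨_, rfl⟩
  have hγ : 0 < γ := by rw [hγdef]; positivity
  have hγℓ : γ * ℓ ≤ δ ^ 2 / 16 := by
    rw [hγdef, div_mul_eq_mul_div, div_le_div_iff₀ (by positivity) (by norm_num)]
    nlinarith [sq_nonneg δ]
  obtain ⟨D, hDdef⟩ : ∃ D : ℕ, D = ⌈(ℓ : ℝ) / γ⌉₊ := ⟨_, rfl⟩
  refine ⟨⌈5 * 2 ^ D / ε⌉₊ + 1, ?_⟩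
  intro n hn S hS N C hcov hsep hsmall m F hloc
  have hn1 : 1 ≤ n := le_trans (Nat.le_add_left 1 _) hn
  have hnpos : (0 : ℝ) < n := by exact_mod_cast hn1
  have hexp : (2 : ℝ) ^ D * Real.exp (-(ε * n)) < 1 / 5 := by
    have h1 : (5 * 2 ^ D / ε : ℝ) < n := by
      calc (5 * 2 ^ D / ε : ℝ) ≤ ⌈5 * 2 ^ D / ε⌉₊ := Nat.le_ceil _
        _ < ((⌈5 * 2 ^ D / ε⌉₊ + 1 : ℕ) : ℝ) := by push_cast; linarith
        _ ≤ n := by exact_mod_cast hn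
    have h2 : 5 * 2 ^ D < ε * n := by
      rw [div_lt_iff₀ hε] at h1; linarith [mul_comm ε (n : ℝ)]
    have h3 : ε * n + 1 ≤ Real.exp (ε * n) := Real.add_one_le_exp _
    rw [Real.exp_neg, ← div_eq_mul_inv, div_lt_div_iff₀ (Real.exp_pos _) (by norm_num : (0 : ℝ) < 5)]
    linarith
  -- suppose every event is 1/3-close
  by_contra hcon
  push Not at hcon
  have hScard : (0 : ℝ) < S.card := by exact_mod_cast hS.card_pos
  -- (1) the sampler hits S with probability ≥ 2/3
  have hPS : (2 / 3 : ℝ) ≤ ((Finset.univ.filter fun r : Fin m → Bool => F r ∈ S).card : ℝ) / 2 ^ m := by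
    have h := hcon S
    rw [Finset.inter_self, div_self hScard.ne', abs_le] at h
    linarith [h.1]
  -- (2) dependency sets and fan-outs
  choose T hTcard hTloc using hloc
  obtain ⟨c, hcdef⟩ : ∃ c : Fin m → ℕ, ∀ j, c j = (Finset.univ.filter fun i : Fin n => j ∈ T i).card :=
    ⟨_, fun j => rfl⟩
  have hcsum : (∑ j, (c j : ℝ)) ≤ ℓ * n := by
    have h1 : ∑ j, c j = ∑ i : Fin n, (T i).card := by
      simp only [hcdef, Finset.card_filter]
      rw [Finset.sum_comm]
      refine Finset.sum_congr rfl fun i _ => ?_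
      rw [← Finset.card_filter, Finset.filter_univ_mem]
    have h2 : ∑ i : Fin n, (T i).card ≤ n * ℓ :=
      (Finset.sum_le_sum fun i _ => hTcard i).trans (by simp)
    calc (∑ j, (c j : ℝ)) = ((∑ j, c j : ℕ) : ℝ) := by push_cast; rfl
      _ ≤ ((n * ℓ : ℕ) : ℝ) := by exact_mod_cast h1 ▸ h2
      _ = ℓ * n := by push_cast; ring
  -- flipping coin j moves the output by at most c j bits
  have hsens : ∀ (j : Fin m) (ρ : Fin m → Bool),
      (hammingDist (F (Function.update ρ j true)) (F (Function.update ρ j false)) : ℝ) ≤ c j := by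
    intro j ρ
    have : hammingDist (F (Function.update ρ j true)) (F (Function.update ρ j false)) ≤ c j := by
      rw [hcdef]
      unfold hammingDist
      refine Finset.card_le_card fun i hi => ?_
      rw [Finset.mem_filter] at hi ⊢
      refine ⟨Finset.mem_univ _, ?_⟩
      by_contra hji
      refine hi.2 (hTloc i _ _ fun j' hj' => ?_)
      have hne : j' ≠ j := fun h => hji (h ▸ hj')
      rw [Function.update_of_ne hne, Function.update_of_ne hne]
    exact_mod_cast this
  -- (3) heavy coins: fan-out ≥ γ n; there are at most D of them
  obtain ⟨Hv, hHv⟩ : ∃ Hv : Finset (Fin m), ∀ j, j ∈ Hv ↔ γ * n ≤ (c j : ℝ) :=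
    ⟨Finset.univ.filter fun j => γ * n ≤ (c j : ℝ), fun j => by simp⟩
  have hHcard : Hv.card ≤ D := by
    have h1 : (Hv.card : ℝ) * (γ * n) ≤ ∑ j ∈ Hv, (c j : ℝ) := by
      rw [← nsmul_eq_mul, ← Finset.sum_const]
      exact Finset.sum_le_sum fun j hj => (hHv j).1 hj
    have h2 : ∑ j ∈ Hv, (c j : ℝ) ≤ ℓ * n :=
      (Finset.sum_le_sum_of_subset_of_nonneg (Finset.subset_univ Hv) fun _ _ _ => Nat.cast_nonneg _).trans
        hcsum
    have h3 : (Hv.card : ℝ) ≤ ℓ / γ := by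
      rw [le_div_iff₀ hγ]
      nlinarith [h1.trans h2]
    have h4 : (Hv.card : ℝ) ≤ D := h3.trans (hDdef ▸ Nat.le_ceil _)
    exact_mod_cast h4
  have hlight : ∀ j, j ∉ Hv → (c j : ℝ) < γ * n := fun j hj => by
    by_contra h
    exact hj ((hHv j).2 (not_lt.1 h))
  -- sensitivity profile once the heavy coins are fixed
  obtain ⟨d, hdH, hdL⟩ : ∃ d : Fin m → ℝ, (∀ j ∈ Hv, d j = 0) ∧ ∀ j ∉ Hv, d j = c j :=
    ⟨fun j => if j ∈ Hv then 0 else (c j : ℝ), fun j hj => if_pos hj, fun j hj => if_neg hj⟩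
  have hdsum : ∑ k, d k ^ 2 ≤ δ ^ 2 / 16 * n ^ 2 := by
    have h1 : ∀ k, d k ^ 2 ≤ γ * n * c k := by
      intro k
      by_cases hk : k ∈ Hv
      · rw [hdH k hk, zero_pow two_ne_zero]
        exact mul_nonneg (mul_nonneg hγ.le hnpos.le) (Nat.cast_nonneg _)
      · rw [hdL k hk, sq]
        exact mul_le_mul_of_nonneg_right (hlight k hk).le (Nat.cast_nonneg _)
    calc ∑ k, d k ^ 2 ≤ ∑ k, γ * n * c k := Finset.sum_le_sum fun k _ => h1 k
      _ = γ * n * ∑ k, (c k : ℝ) := by rw [Finset.mul_sum]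
      _ ≤ γ * n * (ℓ * n) := mul_le_mul_of_nonneg_left hcsum (mul_nonneg hγ.le hnpos.le)
      _ = (γ * ℓ) * n ^ 2 := by ring
      _ ≤ δ ^ 2 / 16 * n ^ 2 := mul_le_mul_of_nonneg_right hγℓ (sq_nonneg _)
  -- (4) branches: overwrite the heavy coins by a pattern κ
  have hmrg_heavy : ∀ (κ : Finset (Fin m)) (x : Fin m → Bool) (k : Fin m), k ∈ Hv → ∀ b : Bool,
      (fun j => if j ∈ Hv then decide (j ∈ κ) else Function.update x k b j) =
        (fun j => if j ∈ Hv then decide (j ∈ κ) else x j) := by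
    intro κ x k hk b
    funext j
    by_cases hj : j ∈ Hv
    · simp [hj]
    · have hne : j ≠ k := fun h => hj (h ▸ hk)
      simp [hj, Function.update_of_ne hne]
  have hmrg_light : ∀ (κ : Finset (Fin m)) (x : Fin m → Bool) (k : Fin m), k ∉ Hv → ∀ b : Bool,
      (fun j => if j ∈ Hv then decide (j ∈ κ) else Function.update x k b j) =
        Function.update (fun j => if j ∈ Hv then decide (j ∈ κ) else x j) k b := by
    intro κ x k hk b
    funext j
    by_cases hjk : j = k
    · subst hjk; simp [hk]
    · simp only [Function.update_of_ne hjk]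
  have hdG : ∀ (κ : Finset (Fin m)) (k : Fin m) (x : Fin m → Bool),
      (hammingDist (F (fun j => if j ∈ Hv then decide (j ∈ κ) else Function.update x k true j))
        (F (fun j => if j ∈ Hv then decide (j ∈ κ) else Function.update x k false j)) : ℝ) ≤ d k := by
    intro κ k x
    by_cases hk : k ∈ Hv
    · rw [hmrg_heavy κ x k hk true, hmrg_heavy κ x k hk false, hammingDist_self, Nat.cast_zero, hdH k hk]
    · rw [hmrg_light κ x k hk true, hmrg_light κ x k hk false, hdL k hk]
      exact hsens k _
  -- (5) in every branch ONE cluster carries all but 2^m/8 of the S-mass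
  have hδn : (0 : ℝ) < δ * n := mul_pos hδ hnpos
  have ht : (2 : ℝ) ^ m * ∑ k, d k ^ 2 ≤ 2 ^ m / 16 * (δ * n) ^ 2 := by
    calc (2 : ℝ) ^ m * ∑ k, d k ^ 2 ≤ 2 ^ m * (δ ^ 2 / 16 * n ^ 2) :=
          mul_le_mul_of_nonneg_left hdsum (by positivity)
      _ = 2 ^ m / 16 * (δ * n) ^ 2 := by ring
  obtain ⟨x₀, hx₀⟩ := hS
  obtain ⟨j₀, -⟩ := hcov x₀ hx₀
  have hbranch := fun κ : Finset (Fin m) =>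
    exists_cluster_ge m n N (fun r => F (fun j => if j ∈ Hv then decide (j ∈ κ) else r j)) d (hdG κ)
      (2 ^ m / 16) (δ * n) hδn ht S C j₀ hcov hsep
  choose jsel hjsel using hbranch
  -- (6) the bad event: union of the selected clusters over the 2^{|Hv|} branches
  obtain ⟨E, hEdef⟩ : ∃ E : Finset (Fin n → Bool), E = Hv.powerset.biUnion fun κ => C (jsel κ) :=
    ⟨_, rfl⟩
  -- its μ_S-mass is < 1/5
  have hμE : ((S ∩ E).card : ℝ) / S.card < 1 / 5 := by
    rw [div_lt_iff₀ hScard]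
    have h1 : ((S ∩ E).card : ℝ) ≤ ∑ κ ∈ Hv.powerset, ((C (jsel κ) ∩ S).card : ℝ) := by
      have : (S ∩ E).card ≤ ∑ κ ∈ Hv.powerset, (C (jsel κ) ∩ S).card := by
        rw [hEdef, Finset.inter_biUnion]
        exact Finset.card_biUnion_le.trans
          (le_of_eq (Finset.sum_congr rfl fun κ _ => by rw [Finset.inter_comm]))
      exact_mod_cast this
    have h2 : ∑ κ ∈ Hv.powerset, ((C (jsel κ) ∩ S).card : ℝ) ≤ 2 ^ D * Real.exp (-(ε * n)) * S.card := by
      calc ∑ κ ∈ Hv.powerset, ((C (jsel κ) ∩ S).card : ℝ)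
          ≤ ∑ _κ ∈ Hv.powerset, Real.exp (-(ε * n)) * S.card := Finset.sum_le_sum fun κ _ => hsmall _
        _ = 2 ^ Hv.card * (Real.exp (-(ε * n)) * S.card) := by
            rw [Finset.sum_const, Finset.card_powerset, nsmul_eq_mul]; push_cast; ring
        _ ≤ 2 ^ D * (Real.exp (-(ε * n)) * S.card) :=
            mul_le_mul_of_nonneg_right (pow_le_pow_right₀ (by norm_num) hHcard) (by positivity)
        _ = 2 ^ D * Real.exp (-(ε * n)) * S.card := by ring
    calc ((S ∩ E).card : ℝ) ≤ 2 ^ D * Real.exp (-(ε * n)) * S.card := h1.trans h2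
      _ < 1 / 5 * S.card := mul_lt_mul_of_pos_right hexp hScard
  -- its sampler-mass is ≥ 2/3 − 1/8 (average over the branches)
  have hPE : (2 / 3 : ℝ) - 1 / 8 ≤ ((Finset.univ.filter fun r : Fin m → Bool => F r ∈ E).card : ℝ) / 2 ^ m := by
    have h2m : (0 : ℝ) < 2 ^ m := by positivity
    have h2H : (0 : ℝ) < 2 ^ Hv.card := by positivity
    have avE := sum_powerset_sum_overwrite m Hv (fun r => if F r ∈ E then (1 : ℝ) else 0)
    have avS := sum_powerset_sum_overwrite m Hv (fun r => if F r ∈ S then (1 : ℝ) else 0)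
    simp only [Finset.sum_boole] at avE avS
    have hge : ∀ κ ∈ Hv.powerset,
        ((Finset.univ.filter fun r : Fin m → Bool =>
            F (fun j => if j ∈ Hv then decide (j ∈ κ) else r j) ∈ S).card : ℝ) - 2 * (2 ^ m / 16) ≤
          ((Finset.univ.filter fun r : Fin m → Bool =>
            F (fun j => if j ∈ Hv then decide (j ∈ κ) else r j) ∈ E).card : ℝ) := by
      intro κ hκ
      refine (hjsel κ).trans ?_
      have hsub : C (jsel κ) ⊆ E := hEdef ▸ Finset.subset_biUnion_of_mem (fun κ => C (jsel κ)) hκ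
      exact_mod_cast Finset.card_le_card fun r hr => by
        rw [Finset.mem_filter] at hr ⊢
        exact ⟨hr.1, hsub hr.2⟩
    have hsum := Finset.sum_le_sum hge
    rw [Finset.sum_sub_distrib, avE, avS, Finset.sum_const, Finset.card_powerset, nsmul_eq_mul] at hsum
    push_cast at hsum
    rw [← mul_sub] at hsum
    have h3 := le_of_mul_le_mul_left hsum h2H
    rw [le_div_iff₀ h2m] at hPS ⊢
    linarith
  -- (7) contradiction with the 1/3-closeness of E
  have h := hcon E
  rw [abs_le] at h
  linarith [h.2]

end Summit.PneNP.PneNP.Theorems
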